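import Summits.NavierStokesRegularity.NavierStokesRegularity.Theorems.PerpetualPumpEulerTypeIGlueTrilinearPrep
import Literature.Analysis.FluidPDE.TaoAveragedFibreIdentity

/-!
# Route PerpetualPump · `EulerTypeIGlue` — stub `stub_cubic` (line `Sketch`): Tao's Euler form (1.3)
# is the physical trilinear form

Main result of the preparations in `PerpetualPumpEulerTypeIGlueTrilinearPrep` /
`PerpetualPumpEulerTypeIGlueTripleProduct`: for a continuous real field `f : ℝ³ → ℝ³` whose
complexified `L²` class `[f^ℂ]` has finite `H¹⁰` norm and is Fourier-divergence-free, and a `C¹` field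
`ψ` with `ψ, Dψ ∈ L¹`, `ψ^ℂ ∈ L²`,
`⟨B([f^ℂ],[f^ℂ]), [ψ^ℂ]⟩ = ∫ ⟪f, (f·∇)ψ⟫ dx`,
where `⟨B(·,·),·⟩ = eulerForm` is Tao's Fourier-side form (1.3)–(1.4)
(`Literature/Analysis/FluidPDE/TaoAveragedSobolev.lean`). Proof: `⟪f,(f·∇)ψ⟫ = Σᵢⱼ fⱼ fᵢ ∂ᵢψⱼ`; each
scalar term is a triple product `∫ a b c` with `a = 𝓕⁻¹(f̂ⱼ)`, `b = 𝓕⁻¹(f̂ᵢ)` a.e. (`f̂ ∈ L¹` for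
`H¹⁰` fields) and `c = ∂ᵢψⱼ ∈ L¹`, so `∫ a b c = ∫∫ f̂ⱼ(ξ₁) f̂ᵢ(ξ₂) ĉ(-ξ₁-ξ₂)` (toolkit VI) with
`ĉ(η) = 2πi ηᵢ ψ̂ⱼ(η)`; resumming, `Σᵢⱼ = 2πi (f̂(ξ₂)·ξ₃)(f̂(ξ₁)·ψ̂(ξ₃))`, `ξ₃ = -ξ₁-ξ₂`; the
divergence-free condition kills `f̂(ξ₂)·ξ₂`, leaving `-2πi ∫∫ (f̂(ξ₂)·ξ₁)(f̂(ξ₁)·ψ̂(ξ₃))`, while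
`-πi ∫∫ Λ` is the sum of this integral and its image under the swap `ξ₁ ↔ ξ₂`. (Sign / `2π`
normalisation cross-checked symbolically on Gaussian test triples, kit job j015106.)

## References

* T. Tao, J. Amer. Math. Soc. 29 (2016), arXiv:1402.0290v3, §1.1 (1.3)–(1.4) ("which one can write
  in Fourier space as …"). [Tao2016AveragedNS]
* E. M. Stein, G. Weiss, *Introduction to Fourier Analysis on Euclidean Spaces* (1971), Ch. I,
  Thm. 1.15 (multiplication formula), Thm. 1.8 (derivatives).
-/

noncomputable section

open MeasureTheory Set Filter Topology FourierTransform SchwartzMap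
open scoped ENNReal NNReal FourierTransform RealInnerProductSpace ContDiff

set_option linter.dupNamespace false

namespace Summit.NavierStokesRegularity.NavierStokesRegularity.Theorems.PerpetualPumpEulerTypeIGlue

section Cubic

open Literature.Analysis.FluidPDE Literature.Analysis.FluidPDE.Tao2016
open Literature.Analysis.FunctionSpaces (eFourierSobolevNorm)
open Literature.Analysis.FunctionSpaces.EuclideanSpace (complexify complexify_apply norm_complexify
  continuous_complexify)

/-- Local notation for physical / frequency space `ℝ³`. -/
local notation "ℝ³" => EuclideanSpace ℝ (Fin 3)
/-- Local notation for the complexified range `ℂ³`. -/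
local notation "ℂ³" => EuclideanSpace ℂ (Fin 3)
/-- The standard unit vectors `e i`. -/
local notation "𝐞ᵤ" i => (EuclideanSpace.single i (1 : ℝ) : EuclideanSpace ℝ (Fin 3))

/-! ### Small algebra -/

/-- `Λ` split into its two summands. [cite: Tao2016AveragedNS, (1.4)] -/
theorem Λ_eq_add (ξ₁ ξ₂ : ℝ³) (X₁ X₂ X₃ : ℂ³) :
    Λ ξ₁ ξ₂ X₁ X₂ X₃ = cdot X₁ (complexify ξ₂) * cdot X₂ X₃ + cdot X₂ (complexify ξ₁) * cdot X₁ X₃ :=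
  rfl

/-! ### The physical side: `⟪f, (f·∇)ψ⟫` as a double sum of scalar triple products -/

variable {f ψ : ℝ³ → ℝ³}

/-- `⟪f, (f·∇)ψ⟫(x) = Σᵢⱼ fⱼ fᵢ ∂ᵢψⱼ`, complexified. [folklore] -/
theorem ofReal_inner_convect_eq_sum (x : ℝ³) :
    (((⟪f x, convect f ψ x⟫ : ℝ)) : ℂ) =
      ∑ i, ∑ j, ((f x j : ℝ) : ℂ) * ((f x i : ℝ) : ℂ) * ((fderiv ℝ ψ x (𝐞ᵤ i) j : ℝ) : ℂ) := by
  rw [convect_apply, inner_clm_apply_eq_sum]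
  push_cast
  rfl

/-- The component `x ↦ ∂ᵢψⱼ(x)` (complexified) is integrable when `Dψ` is. [folklore] -/
theorem integrable_fderiv_component (hψ' : Integrable (fderiv ℝ ψ)) (i j : Fin 3) :
    Integrable (fun x => ((fderiv ℝ ψ x (𝐞ᵤ i) j : ℝ) : ℂ)) := by
  have h1 : Integrable (fun x => fderiv ℝ ψ x (𝐞ᵤ i)) := hψ'.apply_continuousLinearMap _
  have h2 : Integrable (fun x => (fderiv ℝ ψ x (𝐞ᵤ i)) j) :=
    (EuclideanSpace.proj j : ℝ³ →L[ℝ] ℝ).integrable_comp h1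
  exact Complex.ofRealCLM.integrable_comp h2

/-- A coordinate of a continuous field is continuous (complexified). [folklore] -/
theorem continuous_ofReal_apply (hf : Continuous f) (j : Fin 3) :
    Continuous (fun x => ((f x j : ℝ) : ℂ)) :=
  Complex.continuous_ofReal.comp ((EuclideanSpace.proj j : ℝ³ →L[ℝ] ℝ).continuous.comp hf)

/-- The scalar triple products `fⱼ fᵢ ∂ᵢψⱼ` are integrable: `fⱼ`, `fᵢ` agree a.e. with inverse
Fourier integrals of integrable functions, hence are a.e. bounded, and `∂ᵢψⱼ ∈ L¹`. [folklore] -/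
theorem integrable_triple (hf : Continuous f) (h2 : MemLp (complexify ∘ f) 2 (volume : Measure ℝ³))
    (hH : eFourierSobolevNorm 10 (h2.toLp _) < ⊤) (hψ' : Integrable (fderiv ℝ ψ)) (i j : Fin 3) :
    Integrable (fun x => ((f x j : ℝ) : ℂ) * ((f x i : ℝ) : ℂ) * ((fderiv ℝ ψ x (𝐞ᵤ i) j : ℝ) : ℂ)) := by
  set F : ℝ³ → ℂ³ := fourierFn (h2.toLp _) with hF
  have hFi : Integrable F := (integrable_fourierFn_and_moment hH).1
  have hA : Integrable (fun ξ => F ξ j) := integrable_apply_of_integrable hFi j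
  have hB : Integrable (fun ξ => F ξ i) := integrable_apply_of_integrable hFi i
  have ha := component_ae_eq_fourierInv h2 hH j
  have hb := component_ae_eq_fourierInv h2 hH i
  have hc := integrable_fderiv_component hψ' i j
  set KA : ℝ := ∫ ξ, ‖F ξ j‖ with hKA
  set KB : ℝ := ∫ ξ, ‖F ξ i‖ with hKB
  refine Integrable.mono' (hc.norm.const_mul (KA * KB))
    (((continuous_ofReal_apply hf j).mul (continuous_ofReal_apply hf i)).aestronglyMeasurable.mul hc.1) ?_
  filter_upwards [ha, hb] with x hx hy
  rw [norm_mul, norm_mul, hx, hy]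
  have h1 := Literature.Analysis.FunctionSpaces.SobolevEmbeddingHalf.norm_fourierIntegralInv_le_integral_norm
    (fun ξ => F ξ j) x
  have h2' := Literature.Analysis.FunctionSpaces.SobolevEmbeddingHalf.norm_fourierIntegralInv_le_integral_norm
    (fun ξ => F ξ i) x
  have hKA0 : 0 ≤ KA := integral_nonneg fun _ => norm_nonneg _
  calc ‖𝓕⁻ (fun ξ => F ξ j) x‖ * ‖𝓕⁻ (fun ξ => F ξ i) x‖ * ‖((fderiv ℝ ψ x (𝐞ᵤ i) j : ℝ) : ℂ)‖
      ≤ KA * KB * ‖((fderiv ℝ ψ x (𝐞ᵤ i) j : ℝ) : ℂ)‖ := by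
        refine mul_le_mul_of_nonneg_right (mul_le_mul h1 h2' (norm_nonneg _) hKA0) (norm_nonneg _)
    _ = KA * KB * ‖((fderiv ℝ ψ x (𝐞ᵤ i) j : ℝ) : ℂ)‖ := rfl

/-! ### The frequency side: integrability on `ℝ³ × ℝ³` -/

/-- The Fourier integral of the complexified test field is continuous. [folklore] -/
theorem continuous_fourier_complexify (hψ1c : Integrable (complexify ∘ ψ)) :
    Continuous (𝓕 (complexify ∘ ψ)) :=
  VectorFourier.fourierIntegral_continuous Real.continuous_fourierChar continuous_inner hψ1c

/-- The Fourier integral is bounded by the `L¹` norm. [folklore] -/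
theorem norm_fourier_complexify_le (ψ : ℝ³ → ℝ³) (η : ℝ³) :
    ‖𝓕 (complexify ∘ ψ) η‖ ≤ ∫ x, ‖(complexify ∘ ψ) x‖ :=
  VectorFourier.norm_fourierIntegral_le_integral_norm 𝐞 volume (innerₗ ℝ³) _ η

/-- Measurability of `p ↦ F p.1` on the product space. [folklore] -/
theorem aestronglyMeasurable_comp_fst' {F : ℝ³ → ℂ³} (hF : AEStronglyMeasurable F volume) :
    AEStronglyMeasurable (fun p : ℝ³ × ℝ³ => F p.1) ((volume : Measure ℝ³).prod volume) :=
  hF.comp_quasiMeasurePreserving Measure.quasiMeasurePreserving_fst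

/-- Measurability of `p ↦ F p.2` on the product space. [folklore] -/
theorem aestronglyMeasurable_comp_snd' {F : ℝ³ → ℂ³} (hF : AEStronglyMeasurable F volume) :
    AEStronglyMeasurable (fun p : ℝ³ × ℝ³ => F p.2) ((volume : Measure ℝ³).prod volume) :=
  hF.comp_quasiMeasurePreserving Measure.quasiMeasurePreserving_snd

/-- Measurability of `p ↦ A(p) · B(p)` for measurable `A`, `B`. [folklore] -/
theorem aestronglyMeasurable_cdot_comp {μ : Measure (ℝ³ × ℝ³)} {A B : ℝ³ × ℝ³ → ℂ³}
    (hA : AEStronglyMeasurable A μ) (hB : AEStronglyMeasurable B μ) :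
    AEStronglyMeasurable (fun p => cdot (A p) (B p)) μ := by
  have h : (fun p => cdot (A p) (B p)) = (fun q : ℂ³ × ℂ³ => cdot q.1 q.2) ∘ fun p => (A p, B p) := rfl
  rw [h]
  exact continuous_cdot.comp_aestronglyMeasurable (hA.prodMk hB)

/-- `‖-ξ₁-ξ₂‖ ≤ ‖ξ₁‖ + ‖ξ₂‖ + 1`. [folklore] -/
theorem norm_neg_sub_le_add_one (ξ₁ ξ₂ : ℝ³) : ‖-ξ₁ - ξ₂‖ ≤ ‖ξ₁‖ + ‖ξ₂‖ + 1 := by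
  calc ‖-ξ₁ - ξ₂‖ ≤ ‖-ξ₁‖ + ‖ξ₂‖ := norm_sub_le _ _
    _ = ‖ξ₁‖ + ‖ξ₂‖ := by rw [norm_neg]
    _ ≤ ‖ξ₁‖ + ‖ξ₂‖ + 1 := le_add_of_nonneg_right zero_le_one

/-- **Integrability of the `(i,j)` frequency-side term** `f̂ⱼ(ξ₁) f̂ᵢ(ξ₂) (2πi ξ₃ᵢ Ĝⱼ(ξ₃))`,
`ξ₃ = -ξ₁-ξ₂`, for `f̂ ∈ L¹` with first moment and `Ĝ` continuous and bounded. [folklore] -/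
theorem integrable_freq_term {F : ℝ³ → ℂ³} (hFi : Integrable F)
    (hFm : Integrable (fun ξ : ℝ³ => ‖ξ‖ * ‖F ξ‖)) {G : ℝ³ → ℂ³} (hG : Continuous G) {KG : ℝ}
    (hGb : ∀ η, ‖G η‖ ≤ KG) (i j : Fin 3) :
    Integrable (fun p : ℝ³ × ℝ³ => F p.1 j * F p.2 i *
      ((2 * Real.pi * Complex.I) * (((-p.1 - p.2) i : ℝ) : ℂ) * G (-p.1 - p.2) j))
      ((volume : Measure ℝ³).prod volume) := by
  have hKG : 0 ≤ KG := (norm_nonneg _).trans (hGb 0)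
  have hq : Continuous fun p : ℝ³ × ℝ³ => -p.1 - p.2 := by fun_prop
  refine integrable_of_dominated hFi hFm ?_ (C := 2 * Real.pi * KG) fun p => ?_
  · refine AEStronglyMeasurable.mul (AEStronglyMeasurable.mul ?_ ?_) ?_
    · exact (EuclideanSpace.proj j : ℂ³ →L[ℂ] ℂ).continuous.comp_aestronglyMeasurable
        (aestronglyMeasurable_comp_fst' hFi.1)
    · exact (EuclideanSpace.proj i : ℂ³ →L[ℂ] ℂ).continuous.comp_aestronglyMeasurable
        (aestronglyMeasurable_comp_snd' hFi.1)
    · refine Continuous.aestronglyMeasurable ?_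
      refine Continuous.mul (continuous_const.mul ?_) ?_
      · exact Complex.continuous_ofReal.comp ((EuclideanSpace.proj i : ℝ³ →L[ℝ] ℝ).continuous.comp hq)
      · exact (EuclideanSpace.proj j : ℂ³ →L[ℂ] ℂ).continuous.comp (hG.comp hq)
  · have h1 : ‖F p.1 j‖ ≤ ‖F p.1‖ := PiLp.norm_apply_le _ _
    have h2 : ‖F p.2 i‖ ≤ ‖F p.2‖ := PiLp.norm_apply_le _ _
    have h3 : ‖(((-p.1 - p.2) i : ℝ) : ℂ)‖ ≤ ‖p.1‖ + ‖p.2‖ + 1 := by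
      rw [Complex.norm_real]
      exact (PiLp.norm_apply_le (-p.1 - p.2) i).trans (norm_neg_sub_le_add_one _ _)
    have h4 : ‖G (-p.1 - p.2) j‖ ≤ KG := (PiLp.norm_apply_le _ _).trans (hGb _)
    have h2π : ‖(2 * Real.pi * Complex.I : ℂ)‖ = 2 * Real.pi := by
      rw [norm_mul, norm_mul, Complex.norm_I, mul_one, Complex.norm_ofNat, Complex.norm_real,
        Real.norm_of_nonneg Real.pi_pos.le]
    rw [norm_mul, norm_mul, norm_mul, norm_mul, h2π]
    have hp0 : 0 ≤ ‖p.1‖ + ‖p.2‖ + 1 := by positivity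
    calc ‖F p.1 j‖ * ‖F p.2 i‖ * (2 * Real.pi * ‖(((-p.1 - p.2) i : ℝ) : ℂ)‖ * ‖G (-p.1 - p.2) j‖)
        ≤ ‖F p.1‖ * ‖F p.2‖ * (2 * Real.pi * (‖p.1‖ + ‖p.2‖ + 1) * KG) := by
          refine mul_le_mul (mul_le_mul h1 h2 (norm_nonneg _) (norm_nonneg _)) ?_ (by positivity)
            (by positivity)
          exact mul_le_mul (mul_le_mul_of_nonneg_left h3 (by positivity)) h4 (norm_nonneg _)
            (by positivity)
      _ = 2 * Real.pi * KG * ((‖p.1‖ + ‖p.2‖ + 1) * ‖F p.1‖ * ‖F p.2‖) := by ring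

/-- **Integrability of the symmetrised term** `(f̂(ξ₂)·ξ₁)(f̂(ξ₁)·Ĝ(ξ₃))`, `ξ₃ = -ξ₁-ξ₂`. [folklore] -/
theorem integrable_Tb {F : ℝ³ → ℂ³} (hFi : Integrable F)
    (hFm : Integrable (fun ξ : ℝ³ => ‖ξ‖ * ‖F ξ‖)) {G : ℝ³ → ℂ³} (hG : Continuous G) {KG : ℝ}
    (hGb : ∀ η, ‖G η‖ ≤ KG) :
    Integrable (fun p : ℝ³ × ℝ³ => cdot (F p.2) (complexify p.1) * cdot (F p.1) (G (-p.1 - p.2)))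
      ((volume : Measure ℝ³).prod volume) := by
  have hKG : 0 ≤ KG := (norm_nonneg _).trans (hGb 0)
  have hq : Continuous fun p : ℝ³ × ℝ³ => -p.1 - p.2 := by fun_prop
  refine integrable_of_dominated hFi hFm ?_ (C := KG) fun p => ?_
  · exact (aestronglyMeasurable_cdot_comp (aestronglyMeasurable_comp_snd' hFi.1)
      (continuous_complexify.comp continuous_fst).aestronglyMeasurable).mul
      (aestronglyMeasurable_cdot_comp (aestronglyMeasurable_comp_fst' hFi.1)
      ((hG.comp hq).aestronglyMeasurable))
  · rw [norm_mul]
    have h1 : ‖cdot (F p.2) (complexify p.1)‖ ≤ ‖F p.2‖ * ‖p.1‖ := by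
      simpa [norm_complexify] using norm_cdot_le (F p.2) (complexify p.1)
    have h2 : ‖cdot (F p.1) (G (-p.1 - p.2))‖ ≤ ‖F p.1‖ * KG :=
      (norm_cdot_le _ _).trans (mul_le_mul_of_nonneg_left (hGb _) (norm_nonneg _))
    calc ‖cdot (F p.2) (complexify p.1)‖ * ‖cdot (F p.1) (G (-p.1 - p.2))‖
        ≤ ‖F p.2‖ * ‖p.1‖ * (‖F p.1‖ * KG) :=
          mul_le_mul h1 h2 (norm_nonneg _) (by positivity)
      _ ≤ ‖F p.2‖ * (‖p.1‖ + ‖p.2‖ + 1) * (‖F p.1‖ * KG) := by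
          gcongr
          linarith [norm_nonneg p.2]
      _ = KG * ((‖p.1‖ + ‖p.2‖ + 1) * ‖F p.1‖ * ‖F p.2‖) := by ring

/-- **Integrability of the swapped term** `(f̂(ξ₁)·ξ₂)(f̂(ξ₂)·Ĝ(ξ₃))`, `ξ₃ = -ξ₁-ξ₂`. [folklore] -/
theorem integrable_Ta {F : ℝ³ → ℂ³} (hFi : Integrable F)
    (hFm : Integrable (fun ξ : ℝ³ => ‖ξ‖ * ‖F ξ‖)) {G : ℝ³ → ℂ³} (hG : Continuous G) {KG : ℝ}
    (hGb : ∀ η, ‖G η‖ ≤ KG) :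
    Integrable (fun p : ℝ³ × ℝ³ => cdot (F p.1) (complexify p.2) * cdot (F p.2) (G (-p.1 - p.2)))
      ((volume : Measure ℝ³).prod volume) := by
  have hKG : 0 ≤ KG := (norm_nonneg _).trans (hGb 0)
  have hq : Continuous fun p : ℝ³ × ℝ³ => -p.1 - p.2 := by fun_prop
  refine integrable_of_dominated hFi hFm ?_ (C := KG) fun p => ?_
  · exact (aestronglyMeasurable_cdot_comp (aestronglyMeasurable_comp_fst' hFi.1)
      (continuous_complexify.comp continuous_snd).aestronglyMeasurable).mul
      (aestronglyMeasurable_cdot_comp (aestronglyMeasurable_comp_snd' hFi.1)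
      ((hG.comp hq).aestronglyMeasurable))
  · rw [norm_mul]
    have h1 : ‖cdot (F p.1) (complexify p.2)‖ ≤ ‖F p.1‖ * ‖p.2‖ := by
      simpa [norm_complexify] using norm_cdot_le (F p.1) (complexify p.2)
    have h2 : ‖cdot (F p.2) (G (-p.1 - p.2))‖ ≤ ‖F p.2‖ * KG :=
      (norm_cdot_le _ _).trans (mul_le_mul_of_nonneg_left (hGb _) (norm_nonneg _))
    calc ‖cdot (F p.1) (complexify p.2)‖ * ‖cdot (F p.2) (G (-p.1 - p.2))‖
        ≤ ‖F p.1‖ * ‖p.2‖ * (‖F p.2‖ * KG) :=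
          mul_le_mul h1 h2 (norm_nonneg _) (by positivity)
      _ ≤ ‖F p.1‖ * (‖p.1‖ + ‖p.2‖ + 1) * (‖F p.2‖ * KG) := by
          gcongr
          linarith [norm_nonneg p.1]
      _ = KG * ((‖p.1‖ + ‖p.2‖ + 1) * ‖F p.1‖ * ‖F p.2‖) := by ring

/-- The swap `ξ₁ ↔ ξ₂` exchanges the two summands of `Λ`: their integrals agree. [folklore] -/
theorem integral_Ta_eq_integral_Tb (F G : ℝ³ → ℂ³) :
    ∫ p, cdot (F p.1) (complexify p.2) * cdot (F p.2) (G (-p.1 - p.2)) ∂((volume : Measure ℝ³).prod volume) =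
      ∫ p, cdot (F p.2) (complexify p.1) * cdot (F p.1) (G (-p.1 - p.2)) ∂((volume : Measure ℝ³).prod volume) := by
  have h := integral_prod_swap (μ := (volume : Measure ℝ³)) (ν := (volume : Measure ℝ³))
    (fun p : ℝ³ × ℝ³ => cdot (F p.2) (complexify p.1) * cdot (F p.1) (G (-p.1 - p.2)))
  rw [← h]
  refine integral_congr_ae (Eventually.of_forall fun p => ?_)
  simp only [Prod.fst_swap, Prod.snd_swap]
  congr 3
  abel

/-- `Σᵢⱼ ∫ Φᵢⱼ = ∫ Σᵢⱼ Φᵢⱼ` for finitely many integrable functions. [folklore] -/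
theorem sum_sum_integral_eq {X : Type*} [MeasurableSpace X] {μ : Measure X}
    (Φ : Fin 3 → Fin 3 → X → ℂ) (h : ∀ i j, Integrable (Φ i j) μ) :
    ∑ i, ∑ j, ∫ x, Φ i j x ∂μ = ∫ x, ∑ i, ∑ j, Φ i j x ∂μ := by
  rw [integral_finsetSum _ (fun i _ => integrable_finsetSum _ (fun j _ => h i j))]
  refine Finset.sum_congr rfl fun i _ => ?_
  rw [integral_finsetSum _ (fun j _ => h i j)]

/-! ### The main identification -/

/-- `⟪η, eᵢ⟫ = ηᵢ`. [folklore] -/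
theorem inner_single_one_right (η : ℝ³) (i : Fin 3) : ⟪η, 𝐞ᵤ i⟫ = η i := by
  rw [EuclideanSpace.inner_single_right]
  simp

/-- The divergence-free condition in the second frequency variable, on the product space:
`f̂(ξ₂) · ξ₂ = 0` for a.e. `(ξ₁, ξ₂)`. [cite: Tao2016AveragedNS, §1.1 p. 3] -/
theorem ae_cdot_snd_eq_zero {u : L2C} (hdf : IsFourierDivFree u) :
    ∀ᵐ p : ℝ³ × ℝ³ ∂((volume : Measure ℝ³).prod volume), cdot (fourierFn u p.2) (complexify p.2) = 0 := by
  have h := (Measure.quasiMeasurePreserving_snd (μ := (volume : Measure ℝ³))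
    (ν := (volume : Measure ℝ³))).ae hdf
  filter_upwards [h] with p hp
  rw [cdot_comm']
  exact hp

/-- **S1 — the cubic Plancherel identity** (Tao 2016, (1.3)–(1.4) versus the physical trilinear
form): for a continuous real field `f` whose complexified `L²` class is in `H¹⁰` and
Fourier-divergence-free, and a `C¹` field `ψ` with `ψ, Dψ ∈ L¹`, `ψ^ℂ ∈ L²`,
`⟨B([f^ℂ],[f^ℂ]), [ψ^ℂ]⟩ = ∫ ⟪f, (f·∇)ψ⟫`. [cite: Tao2016AveragedNS, §1.1 (1.3)-(1.4)] -/
theorem stub_cubic {f ψ : ℝ³ → ℝ³} (hf : Continuous f)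
    (h2 : MemLp (complexify ∘ f) 2 (volume : Measure ℝ³))
    (hH : eFourierSobolevNorm 10 (h2.toLp _) < ⊤) (hdf : IsFourierDivFree (h2.toLp _))
    (hψ : ContDiff ℝ 1 ψ) (hψ1 : Integrable ψ) (hψ' : Integrable (fderiv ℝ ψ))
    (hψ2 : MemLp (complexify ∘ ψ) 2 (volume : Measure ℝ³)) :
    eulerForm (h2.toLp _) (h2.toLp _) (hψ2.toLp _) = ((∫ x, ⟪f x, convect f ψ x⟫ : ℝ) : ℂ) := by
  -- the Fourier data
  set F : ℝ³ → ℂ³ := fourierFn (h2.toLp _) with hF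
  have hFi : Integrable F := (integrable_fourierFn_and_moment hH).1
  have hFm : Integrable (fun ξ : ℝ³ => ‖ξ‖ * ‖F ξ‖) := (integrable_fourierFn_and_moment hH).2
  have hψ1c : Integrable (complexify ∘ ψ) := complexify.toContinuousLinearMap.integrable_comp hψ1
  set G : ℝ³ → ℂ³ := 𝓕 (complexify ∘ ψ) with hG
  have hGc : Continuous G := continuous_fourier_complexify hψ1c
  have hGb : ∀ η, ‖G η‖ ≤ ∫ x, ‖(complexify ∘ ψ) x‖ := fun η => norm_fourier_complexify_le ψ η
  have hGae : fourierFn (hψ2.toLp _) =ᵐ[volume] G :=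
    Literature.Analysis.FunctionSpaces.fourier_toLp_ae_eq_fourierIntegral hψ1c hψ2
  -- the two product-space terms
  set Ta : ℝ³ × ℝ³ → ℂ := fun p => cdot (F p.1) (complexify p.2) * cdot (F p.2) (G (-p.1 - p.2))
    with hTa
  set Tb : ℝ³ × ℝ³ → ℂ := fun p => cdot (F p.2) (complexify p.1) * cdot (F p.1) (G (-p.1 - p.2))
    with hTb
  have hTai : Integrable Ta ((volume : Measure ℝ³).prod volume) := integrable_Ta hFi hFm hGc hGb
  have hTbi : Integrable Tb ((volume : Measure ℝ³).prod volume) := integrable_Tb hFi hFm hGc hGb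
  -- LHS `= -πi (∫ Ta + ∫ Tb) = -2πi ∫ Tb`
  have hL : eulerForm (h2.toLp _) (h2.toLp _) (hψ2.toLp _) =
      -(2 * Real.pi * Complex.I) * ∫ p, Tb p ∂((volume : Measure ℝ³).prod volume) := by
    unfold eulerForm
    rw [Measure.volume_eq_prod]
    have hae : (fun p : ℝ³ × ℝ³ =>
        Λ p.1 p.2 (F p.1) (F p.2) (fourierFn (hψ2.toLp _) (-p.1 - p.2))) =ᵐ[(volume : Measure ℝ³).prod volume]
        fun p => Ta p + Tb p := by
      filter_upwards [quasiMeasurePreserving_neg_fst_sub_snd.ae_eq hGae] with p hp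
      simp only [Function.comp_apply] at hp
      rw [hp]
      exact Λ_eq_add _ _ _ _ _
    rw [integral_congr_ae hae, integral_add hTai hTbi, integral_Ta_eq_integral_Tb F G]
    ring
  -- RHS, step 1: the double sum of scalar triple products
  have hR1 : ((∫ x, ⟪f x, convect f ψ x⟫ : ℝ) : ℂ) =
      ∑ i, ∑ j, ∫ x, ((f x j : ℝ) : ℂ) * ((f x i : ℝ) : ℂ) * ((fderiv ℝ ψ x (𝐞ᵤ i) j : ℝ) : ℂ) := by
    rw [← integral_complex_ofReal]
    simp_rw [ofReal_inner_convect_eq_sum]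
    exact (sum_sum_integral_eq _ (fun i j => integrable_triple hf h2 hH hψ' i j)).symm
  -- RHS, step 2: each triple product on the Fourier side
  have hR2 : ∀ i j : Fin 3,
      ∫ x, ((f x j : ℝ) : ℂ) * ((f x i : ℝ) : ℂ) * ((fderiv ℝ ψ x (𝐞ᵤ i) j : ℝ) : ℂ) =
        ∫ p, F p.1 j * F p.2 i * ((2 * Real.pi * Complex.I) * (((-p.1 - p.2) i : ℝ) : ℂ) *
          G (-p.1 - p.2) j) ∂((volume : Measure ℝ³).prod volume) := by
    intro i j
    rw [integral_mul_mul_eq_integral_prod (integrable_apply_of_integrable hFi j)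
      (integrable_apply_of_integrable hFi i) (integrable_fderiv_component hψ' i j)
      (component_ae_eq_fourierInv h2 hH j) (component_ae_eq_fourierInv h2 hH i), Measure.volume_eq_prod]
    refine integral_congr_ae (Eventually.of_forall fun p => ?_)
    dsimp only
    rw [fourier_component_fderiv hψ hψ1c hψ' (𝐞ᵤ i) (-p.1 - p.2) j, inner_single_one_right]
  -- RHS, step 3: resum inside the integral
  have hR3 : ∑ i, ∑ j, ∫ p, F p.1 j * F p.2 i * ((2 * Real.pi * Complex.I) * (((-p.1 - p.2) i : ℝ) : ℂ) *
        G (-p.1 - p.2) j) ∂((volume : Measure ℝ³).prod volume) =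
      ∫ p, (2 * Real.pi * Complex.I) * cdot (F p.2) (complexify (-p.1 - p.2)) *
        cdot (F p.1) (G (-p.1 - p.2)) ∂((volume : Measure ℝ³).prod volume) := by
    refine (sum_sum_integral_eq _ (fun i j => integrable_freq_term hFi hFm hGc hGb i j)).trans ?_
    refine integral_congr_ae (Eventually.of_forall fun p => ?_)
    dsimp only
    rw [← sum_sum_eq_cdot]
    refine Finset.sum_congr rfl fun i _ => Finset.sum_congr rfl fun j _ => ?_
    rw [complexify_apply]
  -- RHS, step 4: the divergence-free condition kills `f̂(ξ₂)·ξ₂`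
  have hR4 : ∫ p, (2 * Real.pi * Complex.I) * cdot (F p.2) (complexify (-p.1 - p.2)) *
        cdot (F p.1) (G (-p.1 - p.2)) ∂((volume : Measure ℝ³).prod volume) =
      -(2 * Real.pi * Complex.I) * ∫ p, Tb p ∂((volume : Measure ℝ³).prod volume) := by
    rw [← integral_const_mul]
    refine integral_congr_ae ?_
    filter_upwards [ae_cdot_snd_eq_zero hdf] with p hp
    rw [hTb]
    dsimp only
    rw [cdot_complexify_neg_sub, hp, sub_zero]
    ring
  rw [hL, hR1]
  simp_rw [hR2]
  rw [hR3, hR4]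

end Cubic

end Summit.NavierStokesRegularity.NavierStokesRegularity.Theorems.PerpetualPumpEulerTypeIGlue

end
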